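import Literature.AlgebraicGeometry.Motives.FlasqueCohomology
import Literature.AlgebraicGeometry.Modules.InjectiveModuleFlasque
import Literature.AlgebraicGeometry.Modules.SheafHomFlasque
import Literature.Algebra.Homology.CartanCriterion
import HarnessLib

/-!
# Flasque sheaves are acyclic on every open: `Hⁱ(U, ℱ) = Extⁱ(ℤ[h_U], ℱ) = 0` for `i > 0`
# (Hartshorne III Prop. 2.5 on the open `U`; injective and `𝓗om`-twisted injective `𝒪_X`-modules)

`Motives/FlasqueCohomology` proves Hartshorne III.2.5 for GLOBAL sections (`Sheaf.H`, i.e.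
`Extⁱ(ℤ_X, ℱ)`). The cohomology of an OPEN `U ⊆ X` used throughout the tree's Čech / Serre-vanishing
cluster is `Hⁱ(U, ℱ) := Extⁱ(ℤ[h_U], ℱ)` computed on the site of `X`
(`Algebra/Homology/CartanCriterion.freeSheaf`, `freeSheafHomEquiv : Hom(ℤ[h_U], ℱ) ≃ ℱ(U)`;
`Modules/AffineVanishing.subsingleton_ext_freeSheaf_of_isAffineOpen` is Serre's theorem in this
form). This file runs the printed proof of III.2.5 for `Γ(U, –)`: embed `ℱ ↪ ℐ` injective, `ℐ` and
`ℐ/ℱ` are flasque (III.2.4, II Ex. 1.16(c)), `ℐ(U) → (ℐ/ℱ)(U)` is onto (II Ex. 1.16(b)), so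
`Ext¹(ℤ[h_U], ℱ) = 0` (`subsingleton_ext_freeSheaf_one_of_surjective`) and
`Extⁱ⁺¹(ℤ[h_U], ℱ) ≅ Extⁱ(ℤ[h_U], ℐ/ℱ)`; induction.

* `subsingleton_ext_freeSheaf_succ_of_isFlasque` — **`Extⁿ⁺¹(ℤ[h_U], ℱ) = 0`** for `ℱ` a flasque
  abelian sheaf on a topological space, every open `U`, every `n`;
* `subsingleton_ext_freeSheaf_succ_of_injective_modules` — the same for the abelian sheaf underlying
  an INJECTIVE `𝒪_X`-module on a scheme (injective modules are flasque, III.2.4,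
  `Modules/InjectiveModuleFlasque`);
* `subsingleton_ext_freeSheaf_succ_sheafHom_of_injective` — and for `𝓗om_{𝒪_X}(E, ℐ)`, `E` finite
  locally free, `ℐ` injective (flasque by `Modules/SheafHomFlasque`, Godement II 3.1.2).

These are the `Γ(U, –)`-acyclicity inputs of Leray's acyclicity argument for a direct image along
an affine morphism (`Modules/PushforwardAcyclicResolution`). Everything is proved; no named facts.

## References

* R. Hartshorne, *Algebraic Geometry*, GTM 52, Springer (1977), II Ex. 1.16 (b),(c), III Lemma 2.4,
  Prop. 2.5 (pp. 207–208). [Hartshorne1977]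
* R. Godement, *Topologie algébrique et théorie des faisceaux*, Hermann (1958), II Thm. 3.1.2–3.1.3.
  [Godement1958]
-/

open CategoryTheory CategoryTheory.Limits CategoryTheory.Abelian Opposite TopologicalSpace
  AlgebraicGeometry
open Literature.Algebra.Homology

universe w' u

namespace Literature.AlgebraicGeometry.Motives

/-! ### Flasque abelian sheaves on a topological space -/

section TopCat

variable {X : TopCat.{u}} [HasExt.{w'} (Sheaf (Opens.grothendieckTopology X) AddCommGrpCat.{u})]

/-- **Hartshorne III.2.5 on an open `U`**: if `ℱ` is a flasque sheaf of abelian groups on a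
topological space `X`, then `Hⁿ⁺¹(U, ℱ) = Extⁿ⁺¹(ℤ[h_U], ℱ) = 0` for every open `U ⊆ X` and every `n`
(the cohomology of `U` computed on the site `Opens X` via the free abelian sheaf `ℤ[h_U]`). Proof as
printed for `Γ(X, –)`, with `Γ(U, –)`: embed `ℱ` in an injective `ℐ`; `ℐ` is flasque (III.2.4) hence so
is `ℐ/ℱ` (II Ex. 1.16(c)) and `ℐ(U) → (ℐ/ℱ)(U)` is onto (II Ex. 1.16(b)), whence `Ext¹(ℤ[h_U], ℱ) = 0`
and `Extⁱ⁺¹(ℤ[h_U], ℱ) ≅ Extⁱ(ℤ[h_U], ℐ/ℱ)`; induction on `i` over all flasque sheaves.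
[cite: Hartshorne1977, III Prop. 2.5 (with II Ex. 1.16 (b),(c) and III Lemma 2.4)] -/
theorem subsingleton_ext_freeSheaf_succ_of_isFlasque
    (F : Sheaf (Opens.grothendieckTopology X) AddCommGrpCat.{u}) [TopCat.Sheaf.IsFlasque F]
    (U : Opens X) (n : ℕ) :
    Subsingleton (Ext.{w'} (freeSheaf.{u} (Opens.grothendieckTopology X) U) F (n + 1)) := by
  induction n generalizing F with
  | zero =>
    have hS : (ShortComplex.cokernelSequence (Injective.ι F)).ShortExact :=
      { exact := ShortComplex.cokernelSequence_exact _
        mono_f := Injective.ι_mono F }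
    haveI : TopCat.Sheaf.IsFlasque (ShortComplex.cokernelSequence (Injective.ι F)).X₁ := ‹_›
    haveI : Injective (ShortComplex.cokernelSequence (Injective.ι F)).X₂ :=
      Injective.injective_under F
    exact subsingleton_ext_freeSheaf_one_of_surjective hS U (surjective_app_of_shortExact hS U)
  | succ n ih =>
    have hS : (ShortComplex.cokernelSequence (Injective.ι F)).ShortExact :=
      { exact := ShortComplex.cokernelSequence_exact _
        mono_f := Injective.ι_mono F }
    haveI : TopCat.Sheaf.IsFlasque (ShortComplex.cokernelSequence (Injective.ι F)).X₁ := ‹_›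
    haveI : Injective (ShortComplex.cokernelSequence (Injective.ι F)).X₂ :=
      Injective.injective_under F
    haveI : TopCat.Sheaf.IsFlasque (ShortComplex.cokernelSequence (Injective.ι F)).X₂ :=
      isFlasque_of_injective _
    haveI : TopCat.Sheaf.IsFlasque (ShortComplex.cokernelSequence (Injective.ι F)).X₃ :=
      isFlasque_of_shortExact hS
    haveI := ih (ShortComplex.cokernelSequence (Injective.ι F)).X₃
    exact Ext.subsingleton_succ_succ_of_injective hS _ n

/-- **Hartshorne III.2.5 on an open `U`**, positive degrees `i > 0`: `Extⁱ(ℤ[h_U], ℱ) = 0` for `ℱ`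
flasque. [cite: Hartshorne1977, III Prop. 2.5] -/
theorem subsingleton_ext_freeSheaf_of_isFlasque
    (F : Sheaf (Opens.grothendieckTopology X) AddCommGrpCat.{u}) [TopCat.Sheaf.IsFlasque F]
    (U : Opens X) (i : ℕ) (hi : 0 < i) :
    Subsingleton (Ext.{w'} (freeSheaf.{u} (Opens.grothendieckTopology X) U) F i) := by
  obtain ⟨n, rfl⟩ := Nat.exists_eq_add_one_of_ne_zero hi.ne'
  exact subsingleton_ext_freeSheaf_succ_of_isFlasque F U n

end TopCat

/-! ### Injective `𝒪_X`-modules and their `𝓗om`-twists on a scheme -/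

section Scheme

variable {X : Scheme.{u}}
  [HasExt.{w'} (Sheaf (Opens.grothendieckTopology X.carrier) AddCommGrpCat.{u})]

/-- **`Hⁿ⁺¹(U, ℐ) = Extⁿ⁺¹(ℤ[h_U], ℐ) = 0` for an injective `𝒪_X`-module `ℐ`** on a scheme and every
open `U` (injective modules are flasque, III.2.4, and flasque sheaves are acyclic on every open,
III.2.5; the abelian sheaf is `SheafOfModules.toSheaf`). [cite: Hartshorne1977, III Lemma 2.4 and Prop. 2.5] -/
theorem subsingleton_ext_freeSheaf_succ_of_injective_modules (I : X.Modules) [Injective I]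
    (U : X.Opens) (n : ℕ) :
    Subsingleton (Ext.{w'} (freeSheaf.{u} (Opens.grothendieckTopology X) U)
      ((SheafOfModules.toSheaf X.ringCatSheaf).obj I) (n + 1)) :=
  haveI := Literature.AlgebraicGeometry.Modules.isFlasque_of_injective_modules I
  subsingleton_ext_freeSheaf_succ_of_isFlasque (X := X.carrier) _ U n

/-- **`Hⁿ⁺¹(U, 𝓗om(E, ℐ)) = Extⁿ⁺¹(ℤ[h_U], 𝓗om(E, ℐ)) = 0`** for `E` a finite locally free and `ℐ` an
injective `𝒪_X`-module on a scheme, every open `U` (`𝓗om(E, ℐ)` is flasque, Godement II 3.1.2 /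
`Modules/SheafHomFlasque`, and flasque sheaves are acyclic on every open, III.2.5).
[cite: Hartshorne1977, III Prop. 2.5] [cite: Godement1958, II Thm. 3.1.2] -/
theorem subsingleton_ext_freeSheaf_succ_sheafHom_of_injective {E : X.Modules}
    (hE : IsFiniteLocallyFree E) (I : X.Modules) [Injective I]
    (U : X.Opens) (n : ℕ) :
    Subsingleton (Ext.{w'} (freeSheaf.{u} (Opens.grothendieckTopology X) U)
      ((SheafOfModules.toSheaf X.ringCatSheaf).obj
        (Literature.AlgebraicGeometry.Modules.sheafHom E I)) (n + 1)) :=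
  haveI := Literature.AlgebraicGeometry.Modules.isFlasque_of_injective_modules I
  haveI := Literature.AlgebraicGeometry.Modules.isFlasque_sheafHom hE I
  subsingleton_ext_freeSheaf_succ_of_isFlasque (X := X.carrier) _ U n

end Scheme

end Literature.AlgebraicGeometry.Motives
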